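import Summits.BirchSwinnertonDyer.BirchSwinnertonDyer.Theorems.ByReductionTypeAtTwoTorsionEulerCharMultNonsplitUpper
import HarnessLib

set_option linter.dupNamespace false -- `…BirchSwinnertonDyer.BirchSwinnertonDyer…` is the cell's nested layout (D-0017)
set_option autoImplicit false

/-!
# Route `ByReductionTypeAtTwo`, crux `MultUpperHalfAtTwo` (stmt-BirchSwinnertonDyer-19922): the CLASS doors from one
# certified NON-SPLIT member, without the print binder `h41ns'` and without `E(ℚ)[2] = 0`

Cell `bsd-2adic` (run/shared/lean/pub/bsd-2adic/), seat `bsd-2adic-tower-1` GEN 31; `--supports stmt-BirchSwinnertonDyer-19922`.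
THEOREMS ONLY (no definition, no named fact, no `sorry`); closes no item; nothing booked; BSD is not proved by any of this.

The per-member doors of the previous file (`TorsionEulerChar.missingUpperBoundAt_two_nonsplit_of_towerGap`,
`…_of_prop514`, control display DISCHARGED by the kernel theorem `constantCoeff_mul_sq_eq_two_nonsplit`) moved across the
isogeny class by Cassels' invariance of the BSD quotient (`missingUpperBoundAt_two_of_isogenous_member`):

* **`missingUpperBoundAt_two_nonsplit_of_towerGapMember`** — twin of seat mult-2's `missingUpperBoundAt_two_nonsplit_of_towerGapMember'`
  with `h41ns'` REMOVED: tower-gap certificate + period datum at a non-split member `W₁` ⟹ `MissingUpperBoundAt W 2`;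
* **`missingUpperBoundAt_two_nonsplit_of_prop514Member`** — a non-split member with a rational `2`-torsion point on Greenberg's
  Prop. 5.14 locus (+ K11a, period datum) ⟹ `MissingUpperBoundAt W 2`;
* §5 `bsdp_two_nonsplit_of_towerGap_of_lowerBound`, `bsdp_two_nonsplit_of_prop514_of_lowerBound` — the end-states per pair
  (`BSDp W 2` from the lower half), without `hEC`.

HONEST FRAMING: assembly; remaining displayed inputs are the MEMO/PRINT binders named in the signatures; closes no item; no summit
statement is proved; the Birch–Swinnerton-Dyer conjecture is NOT proved by any of this.

References: [GreenbergLNM1716] §4 pp. 112–113, Prop. 5.14 (p. 121); [Cassels1965ArithmeticVIII]; [Cesnavicius2018] Thm. 1.2;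
[Miller2011LMS] Def. 1.1; [Washington1997] §13.2.
-/

noncomputable section

open scoped Classical MatrixGroups ModularForm

open NumberField IsDedekindDomain CongruenceSubgroup WeierstrassCurve Literature.NumberTheory.EllipticCurves
  Literature.NumberTheory.EllipticCurves.ModularForms
  Literature.NumberTheory.EllipticCurves.Greenberg1999
  Literature.NumberTheory.EllipticCurves.Wuthrich2014
  Literature.NumberTheory.EllipticCurves.Rank1Residual
  Literature.NumberTheory.EllipticCurves.Rank1Residual.Typed
  Summit.BirchSwinnertonDyer.Rank1Residual.X5 Summit.BirchSwinnertonDyer.Rank1Residual.X5.O1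

namespace Summit.BirchSwinnertonDyer.BirchSwinnertonDyer.Theorems.TorsionEulerChar

/-! ## §4 The class doors (one NON-SPLIT member certified), without `h41ns'` -/

/-- **THE TOWER ROAD FOR THE CLASS FROM A NON-SPLIT MEMBER, NO `h41ns'`, NO `E(ℚ)[2] = 0`.** For `W` of analytic rank `0`
multiplicative at `2` and an isogenous globally minimal member `W₁ ~_ℚ W`, NON-SPLIT multiplicative at `2`, carrying a
tower-gap certificate `O1.TowerGapAtTwo W₁` and a period datum (`Irr W₁ 2`, or a lattice-optimal parametrisation datum at level
`N_{W₁}`, or `0 ≤ ord₂ ϖ` displayed): `MissingUpperBoundAt W 2` at EVERY member, from PRINT {modularity, GZK, Cassels, Česnavičius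
`hC`} + ONE MEMO {Kato `⊗ℚ` at a multiplicative `2` for every non-CM curve}. Twin of
`missingUpperBoundAt_two_nonsplit_of_towerGapMember'` with the print binder `h41ns'` (Greenberg's display at a non-split `2`)
REMOVED — it is now the kernel theorem `constantCoeff_mul_sq_eq_two_nonsplit` (one-sided, which is all the road uses).
[cite: GreenbergLNM1716, §4 pp. 112–113] [cite: Cesnavicius2018, Thm. 1.2] [cite: Cassels1965ArithmeticVIII] [cite: Washington1997, §13.2]
[cite: Miller2011LMS, Def. 1.1] -/
theorem missingUpperBoundAt_two_nonsplit_of_towerGapMember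
    (hKato : ∀ (W : WeierstrassCurve ℚ) [W.IsElliptic] [W.IsGloballyMinimal],
      ¬ W.HasCM → Mult W 2 → KatoMultiplicativeDivisibilityRat W 2)
    (hmod : nonempty_modularParametrizationData)
    (hGZK : rank_eq_analyticRank_of_analyticRank_le_one)
    (hCassels : bsdRHS_eq_of_isIsogenous)
    (hC : cesnavicius_not_two_dvd_maninConstant_of_two_dvd_level)
    (W : WeierstrassCurve ℚ) [W.IsElliptic] [W.IsGloballyMinimal]
    (hr : W.analyticRank = 0) (hmult : Mult W 2)
    (W₁ : WeierstrassCurve ℚ) [W₁.IsElliptic] [W₁.IsGloballyMinimal] (hiso : IsIsogenous W W₁)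
    (hns₁ : ¬ W₁.HasSplitMultiplicativeReductionAtPrime 2)
    (hgap : TowerGapAtTwo W₁)
    (hB : Irr W₁ 2 ∨
      (∀ [NeZero (W₁.conductorNorm ℤ)],
        ∃ D : ModularParametrizationData W₁ (W₁.conductorNorm ℤ), Zhai2021.IsOptimalDatum W₁ D) ∨
      (∀ [NeZero (W₁.conductorNorm ℤ)] (f : CuspForm (Gamma0 (W₁.conductorNorm ℤ)) 2),
        IsNewformOf W₁ f → ∀ ϖ : ℚ, (ϖ : ℝ) * W₁.realPeriodRat = plusPeriod f →
          0 ≤ padicValRat 2 ϖ)) :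
    MissingUpperBoundAt W 2 := by
  -- adapted from `missingUpperBoundAt_two_nonsplit_of_towerGapMember'` (seat bsd-2adic-mult-2)
  have hmult₁ : Mult W₁ 2 :=
    Summit.BirchSwinnertonDyer.Rank1Residual.X2.IsogenyQuotientLine.hasMultiplicativeReductionAtPrime_of_isIsogenous
      hiso hmult
  have hr₁ : W₁.analyticRank = 0 := (analyticRank_eq_of_isIsogenous' hiso).symm.trans hr
  have hcm₁ : ¬ W₁.HasCM := fun h ↦ Rank1Residual.not_mult_of_hasCM W₁ h 2 hmult₁
  have hper₁ : ∀ [NeZero (W₁.conductorNorm ℤ)] (f : CuspForm (Gamma0 (W₁.conductorNorm ℤ)) 2),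
      IsNewformOf W₁ f → ∀ ϖ : ℚ, (ϖ : ℝ) * W₁.realPeriodRat = plusPeriod f →
        0 ≤ padicValRat 2 ϖ := by
    rcases hB with hirr | hopt | hper
    · intro _ f hf ϖ hϖ
      exact (padicValRat_periodRatio_eq_zero_of_irr_two hC W₁ hmult₁ hirr f hf ϖ hϖ).ge
    · intro _ f hf ϖ hϖ
      obtain ⟨D, hD⟩ := hopt
      exact (padicValRat_periodRatio_eq_zero_of_isOptimalDatum hC W₁ hmult₁ D hD f hf ϖ hϖ).ge
    · exact hper
  have hU₁ : MissingUpperBoundAt W₁ 2 :=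
    missingUpperBoundAt_two_nonsplit_of_towerGap W₁ (hKato W₁ hcm₁ hmult₁) hmod hGZK hper₁ hgap hr₁ hmult₁ hns₁
  exact missingUpperBoundAt_two_of_isogenous_member hmod hGZK hCassels W hr W₁ hiso hU₁

/-- **THE PROP. 5.14 ROAD FOR THE CLASS FROM A NON-SPLIT MEMBER WITH A RATIONAL `2`-TORSION POINT, NO `hEC`.** For `W` of
analytic rank `0` multiplicative at `2` and an isogenous globally minimal member `W₁ ~_ℚ W`, non-split multiplicative at `2`,
with a rational `2`-torsion point `(x, y)` ramified at `2` XOR odd (Greenberg Prop. 5.14: `μ = 0`, PRINT `h514`), K11a at `W₁`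
(`hK`), and the period datum `0 ≤ ord₂ ϖ` at `W₁` displayed: `MissingUpperBoundAt W 2` (Cassels moves it across the class).
[cite: GreenbergLNM1716, Prop. 5.14 (p. 121) and §4 pp. 112–113] [cite: Cassels1965ArithmeticVIII] [cite: Miller2011LMS, Def. 1.1] -/
theorem missingUpperBoundAt_two_nonsplit_of_prop514Member (h514 : prop514_isTorsion_mu_eq_zero_two)
    (hmod : nonempty_modularParametrizationData)
    (hGZK : rank_eq_analyticRank_of_analyticRank_le_one)
    (hCassels : bsdRHS_eq_of_isIsogenous)
    (W : WeierstrassCurve ℚ) [W.IsElliptic] [W.IsGloballyMinimal]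
    (hr : W.analyticRank = 0) (hmult : Mult W 2)
    (W₁ : WeierstrassCurve ℚ) [W₁.IsElliptic] [W₁.IsGloballyMinimal] (hiso : IsIsogenous W W₁)
    (hns₁ : ¬ W₁.HasSplitMultiplicativeReductionAtPrime 2)
    (hK : ∀ [NeZero (W₁.conductorNorm ℤ)] (f : CuspForm (Gamma0 (W₁.conductorNorm ℤ)) 2)
      (L : PowerSeries ℚ_[2]), KatoDivisibilityAtTwoNonsplitMultRat W₁ f L)
    (hper₁ : ∀ [NeZero (W₁.conductorNorm ℤ)] (f : CuspForm (Gamma0 (W₁.conductorNorm ℤ)) 2),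
      IsNewformOf W₁ f → ∀ ϖ : ℚ, (ϖ : ℝ) * W₁.realPeriodRat = plusPeriod f → 0 ≤ padicValRat 2 ϖ)
    {x y : ℚ} (hP : W₁.toAffine.Equation x y) (h2 : 2 * y + W₁.a₁ * x + W₁.a₃ = 0)
    (hΦ : (TwoTorsionRamifiedAtTwo x ∧ ¬ TwoTorsionOdd W₁ x) ∨
      (TwoTorsionOdd W₁ x ∧ ¬ TwoTorsionRamifiedAtTwo x)) : MissingUpperBoundAt W 2 := by
  have hmult₁ : Mult W₁ 2 :=
    Summit.BirchSwinnertonDyer.Rank1Residual.X2.IsogenyQuotientLine.hasMultiplicativeReductionAtPrime_of_isIsogenous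
      hiso hmult
  have hr₁ : W₁.analyticRank = 0 := (analyticRank_eq_of_isIsogenous' hiso).symm.trans hr
  have hU₁ : MissingUpperBoundAt W₁ 2 :=
    missingUpperBoundAt_two_nonsplit_of_prop514 W₁ h514 hmod hGZK hK hper₁ hr₁ hmult₁ hns₁ hP h2 hΦ
  exact missingUpperBoundAt_two_of_isogenous_member hmod hGZK hCassels W hr W₁ hiso hU₁

/-! ## §5 End-states per pair: `BSD(E,2)` from the lower half, without `hEC` -/

/-- **`BSD(E,2)` at a NON-SPLIT multiplicative `2` from a tower-gap certificate, K11a, the period datum and the LOWER half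
(`MissingLowerBoundAt W 2`), NO `hEC`, NO `E(ℚ)[2] = 0`** (`missingUpperBoundAt_two_nonsplit_of_towerGap` + lower half ⇒
`MissingPPartAt W 2` ⇒ `BSDp W 2` by GZK). [cite: Miller2011LMS, Def. 1.1 and §1] [cite: GreenbergLNM1716, §4 pp. 112–113] -/
theorem bsdp_two_nonsplit_of_towerGap_of_lowerBound (W : WeierstrassCurve ℚ) [W.IsElliptic] [W.IsGloballyMinimal]
    (hKato : KatoMultiplicativeDivisibilityRat W 2) (hmod : nonempty_modularParametrizationData)
    (hGZK : rank_eq_analyticRank_of_analyticRank_le_one)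
    (hper₀ : ∀ [NeZero (W.conductorNorm ℤ)] (f : CuspForm (Gamma0 (W.conductorNorm ℤ)) 2),
      IsNewformOf W f → ∀ ϖ : ℚ, (ϖ : ℝ) * W.realPeriodRat = plusPeriod f → 0 ≤ padicValRat 2 ϖ)
    (hgap : TowerGapAtTwo W) (hr : W.analyticRank = 0) (hmult : Mult W 2)
    (hns : ¬ W.HasSplitMultiplicativeReductionAtPrime 2) (hlow : MissingLowerBoundAt W 2) : BSDp W 2 :=
  bsdp_of_missingPPartAt W 2 hGZK (by rw [hr]; exact zero_le_one)
    (missingPPartAt_of_lower_of_upper W 2 hlow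
      (missingUpperBoundAt_two_nonsplit_of_towerGap W hKato hmod hGZK hper₀ hgap hr hmult hns))

/-- **`BSD(E,2)` on Greenberg's Prop. 5.14 locus at a NON-SPLIT multiplicative `2` from K11a, the period datum and the LOWER
half, NO `hEC`** — the α-ns end-state per pair for curves WITH a rational `2`-torsion point (ramified at `2` XOR odd).
[cite: GreenbergLNM1716, Prop. 5.14 (p. 121) and §4 pp. 112–113] [cite: Miller2011LMS, Def. 1.1 and §1] -/
theorem bsdp_two_nonsplit_of_prop514_of_lowerBound (W : WeierstrassCurve ℚ) [W.IsElliptic] [W.IsGloballyMinimal]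
    (h514 : prop514_isTorsion_mu_eq_zero_two) (hmod : nonempty_modularParametrizationData)
    (hGZK : rank_eq_analyticRank_of_analyticRank_le_one)
    (hK : ∀ [NeZero (W.conductorNorm ℤ)] (f : CuspForm (Gamma0 (W.conductorNorm ℤ)) 2)
      (L : PowerSeries ℚ_[2]), KatoDivisibilityAtTwoNonsplitMultRat W f L)
    (hper₀ : ∀ [NeZero (W.conductorNorm ℤ)] (f : CuspForm (Gamma0 (W.conductorNorm ℤ)) 2),
      IsNewformOf W f → ∀ ϖ : ℚ, (ϖ : ℝ) * W.realPeriodRat = plusPeriod f → 0 ≤ padicValRat 2 ϖ)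
    (hr : W.analyticRank = 0) (hmult : Mult W 2) (hns : ¬ W.HasSplitMultiplicativeReductionAtPrime 2)
    {x y : ℚ} (hP : W.toAffine.Equation x y) (h2 : 2 * y + W.a₁ * x + W.a₃ = 0)
    (hΦ : (TwoTorsionRamifiedAtTwo x ∧ ¬ TwoTorsionOdd W x) ∨
      (TwoTorsionOdd W x ∧ ¬ TwoTorsionRamifiedAtTwo x)) (hlow : MissingLowerBoundAt W 2) : BSDp W 2 :=
  bsdp_of_missingPPartAt W 2 hGZK (by rw [hr]; exact zero_le_one)
    (missingPPartAt_of_lower_of_upper W 2 hlow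
      (missingUpperBoundAt_two_nonsplit_of_prop514 W h514 hmod hGZK hK hper₀ hr hmult hns hP h2 hΦ))

end Summit.BirchSwinnertonDyer.BirchSwinnertonDyer.Theorems.TorsionEulerChar

end
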